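import Literature.Computability.Complexity.GateEliminationDoomed
import Literature.Computability.Complexity.GateEliminationCase1
import Literature.Computability.Complexity.GateEliminationNormalize

/-!
# Gate elimination: Case 3 of Li–Yang's proof of Theorem 4.1

"There is a variable `x` feeding an ∧-type gate `G`, such that the total out-degree of `x` and
`G` is at least `4`. We perform appropriate constant substitution to `x` to trivialize `G`, while
at least `3` descendants of `x` and `G` are degenerate. If a gate is fed by both `G` and `x`
(i.e. double counted), it is then trivialized and its descendants are degenerated. To sum up, at
least four gates are eliminated by Rule 2 and Rule 3, so `Δμ ≥ 4 - 4α_φ + α_I ≥ δ`."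
(ECCC TR21-023, §4.1, Case 3; `x` is unprotected by Case 1.)

Formalization: after `x := c` (`substConst`/`assignFree`), the readers of `x` are fed by a
constant, `G` is syntactically constant (`SynVal`), so its readers are doomed; a double-counted
reader `Q` is syntactically constant in turn, hence not the output, hence read by a further
doomed gate (twice over if that reader is again among the counted ones); in a pre-normalized
circuit this yields `4` doomed gates (`four_le_card_doomed`), eliminated by `cascade_doomed`.

## References

* J. Li, T. Yang, *3.1n − o(n) circuit lower bounds for explicit functions*, STOC 2022;
  ECCC TR21-023, §4.1 (Case 3), Lemma 3.11.
-/

namespace Literature.Computability.Complexity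

open Finset

/-- `δ ≤ α_I + (4 - 4α_φ)` (the third term of the minimum). [cite: LiYang2022, Thm. 4.1] -/
theorem liYangDelta_le_case3 (αφ αI αQ : ℝ) : liYangDelta αφ αI αQ ≤ αI + (4 - 4 * αφ) := by
  unfold liYangDelta
  have h1 : min (αI / 3) (min (2 - 2 * αφ + αQ) (min (4 - 4 * αφ) (min (3 + αφ) (min (5 - αQ)
      ((5 - 2 * αφ + αQ) / 2))))) ≤ min (2 - 2 * αφ + αQ) (min (4 - 4 * αφ) (min (3 + αφ) (min (5 - αQ)
      ((5 - 2 * αφ + αQ) / 2)))) := min_le_right _ _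
  have h2 : min (2 - 2 * αφ + αQ) (min (4 - 4 * αφ) (min (3 + αφ) (min (5 - αQ)
      ((5 - 2 * αφ + αQ) / 2)))) ≤ min (4 - 4 * αφ) (min (3 + αφ) (min (5 - αQ) ((5 - 2 * αφ + αQ) / 2))) :=
    min_le_right _ _
  have h3 : min (4 - 4 * αφ) (min (3 + αφ) (min (5 - αQ) ((5 - 2 * αφ + αQ) / 2))) ≤ 4 - 4 * αφ := min_le_left _ _
  linarith

namespace Semicircuit

variable {n : ℕ}

/-! ### Generalities -/

/-- A gate fed by a constant with constant live function is syntactically constant.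
[cite: LiYang2022, §3.3 (Rule 2)] -/
theorem SynVal.of_trivialized (D : Semicircuit n) {k₀ : Fin D.m} {a₀ : Fin 2} {b₀ : Bool}
    (h₀ : D.arg k₀ a₀ = .const b₀) (htriv : D.liveFn k₀ a₀ b₀ false = D.liveFn k₀ a₀ b₀ true) :
    D.SynVal (.gate k₀) (D.liveFn k₀ a₀ b₀ false) := by
  have hlive : ∀ t, D.liveFn k₀ a₀ b₀ t = D.liveFn k₀ a₀ b₀ false := fun t => by
    cases t; exacts [rfl, htriv.symm]
  obtain rfl | rfl : a₀ = 0 ∨ a₀ = 1 := by fin_cases a₀ <;> simp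
  · refine .left (c := b₀) (h₀ ▸ .const b₀) fun q => ?_
    have := hlive q; unfold liveFn at this ⊢; rwa [if_pos rfl, if_pos rfl] at *
  · refine .right (c := b₀) (h₀ ▸ .const b₀) fun p => ?_
    have := hlive p; unfold liveFn at this ⊢; rwa [if_neg (by decide), if_neg (by decide)] at *

/-- A gate both of whose wires are syntactically constant is syntactically constant. [folklore] -/
theorem SynVal.of_wires (D : Semicircuit n) {k : Fin D.m} (h : ∀ a, ∃ c, D.SynVal (D.arg k a) c) :
    ∃ b, D.SynVal (.gate k) b := by
  obtain ⟨c₀, h0⟩ := h 0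
  obtain ⟨c₁, h1⟩ := h 1
  exact ⟨_, .both h0 h1 rfl⟩

/-- The readers of a node. [folklore] -/
theorem fanout_eq_card_readers (D : Semicircuit n) (hN : ∀ k, D.arg k 0 ≠ D.arg k 1) (v : Node n D.m) :
    D.fanout v = (univ.filter fun k => ∃ a, D.arg k a = v).card := by
  classical
  unfold fanout
  rw [card_eq_sum_ones, sum_filter]
  refine sum_congr rfl fun k _ => ?_
  by_cases hk : ∃ a, D.arg k a = v
  · rw [if_pos hk]
    obtain ⟨a, ha⟩ := hk
    rw [card_eq_one]
    refine ⟨a, ?_⟩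
    ext a'
    simp only [mem_filter, mem_univ, true_and, mem_singleton]
    constructor
    · intro h
      by_contra hne
      have h01 : D.arg k 0 = D.arg k 1 := by
        obtain rfl | rfl : a = 0 ∨ a = 1 := by fin_cases a <;> simp
        all_goals obtain rfl | rfl : a' = 0 ∨ a' = 1 := by fin_cases a' <;> simp
        all_goals first | exact absurd rfl hne | rw [h, ha]
      exact hN k h01
    · rintro rfl; exact ha
  · rw [if_neg hk, card_eq_zero, filter_eq_empty_iff]
    exact fun a _ h => hk ⟨a, h⟩

/-- Ranks of acyclic gates increase strictly along wires; a reader of an acyclic gate is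
acyclic. [cite: LiYang2022, Def. 2.5] -/
theorem exists_rank (D : Semicircuit n) : ∃ ρ : Fin D.m → ℕ, ∀ (k k' : Fin D.m) (a : Fin 2),
    D.arg k' a = .gate k → k ∉ D.xorPart → k' ∉ D.xorPart ∧ ρ k < ρ k' := by
  obtain ⟨ρ, hρ⟩ := D.acyclic
  refine ⟨ρ, fun k k' a h hk => ?_⟩
  have hk' : k' ∉ D.xorPart := fun hk' => hk (D.mem_of_arg_eq k' hk' a k h)
  exact ⟨hk', hρ k' hk' a k h hk⟩

/-- In `Fin 2`, a point other than `a` is the point other than `a`. [folklore] -/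
theorem fin2_eq_of_ne_of_ne : ∀ {a a' p : Fin 2}, a ≠ a' → p ≠ a → p = a' := by decide

section Case3

variable {C : Semicircuit n} {f : (Fin n → ZMod 2) → Bool} {R : RdqSource n} {d : ℕ}
  {αφ αI αQ : ℝ} {P : Finset (Fin C.m × Fin C.m)}

/-- **The accounting of a constant substitution to an unprotected influential variable followed
by `r` eliminations**: `Δμ ≥ α_I + r(1 - α_φ)`, one substitution; enough as soon as
`δ ≤ α_I + r(1 - α_φ)`. [cite: LiYang2022, §4.1 (Cases 3, 4)] -/
theorem stepBranch2_of_assignFree_elims (hφ : 0 ≤ αφ) (hI : 0 ≤ αI)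
    {j : Fin n} (hj : R.Free j) (hjp : ¬ R.Protected j) (c : ZMod 2) (hP : C.IsPacking P)
    (hjinf : j ∈ C.influential R) (r : ℕ) (hδ : liYangDelta αφ αI αQ ≤ αI + r * (1 - αφ))
    {D' : Semicircuit n} {P' : Finset (Fin D'.m × Fin D'.m)} (hF' : D'.Fair)
    (hC' : D'.ComputesRestr f (R.assignFree j c hj hjp)) (hP' : D'.IsPacking P')
    (hμ' : D'.measure αφ αI αQ P' (R.assignFree j c hj hjp) ≤
      (C.substConst j (finTwoEquiv c)).measure αφ αI αQ (C.substConstPacking j (finTwoEquiv c) P)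
        (R.assignFree j c hj hjp) - r * (1 - αφ)) :
    C.StepBranch2 f R αφ αI αQ P := by
  classical
  have hsub := measure_substConst_le hφ αI αQ hP R (R.assignFree j c hj hjp) j (finTwoEquiv c)
  have hinf : (((C.substConst j (finTwoEquiv c)).influential (R.assignFree j c hj hjp)).card : ℝ) + 1 ≤
      (C.influential R).card := by
    have h1 := card_le_card (C.influential_substConst_assignFree_subset hj hjp c (finTwoEquiv c))
    have h3 := card_erase_of_mem hjinf
    have h4 := card_pos.mpr ⟨j, hjinf⟩
    have : ((C.substConst j (finTwoEquiv c)).influential (R.assignFree j c hj hjp)).card + 1 ≤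
        (C.influential R).card := by omega
    exact_mod_cast this
  have hq : ((R.assignFree j c hj hjp).quadCount : ℝ) = R.quadCount := by
    rw [RdqSource.quadCount_assignFree]
  refine ⟨1, le_rfl, by norm_num, D', R.assignFree j c hj hjp, P', hF', hC', hP',
    RdqSource.dim_assignFree hj hjp, ?_⟩
  simp only [Nat.cast_one, mul_one]
  rw [hq, sub_self, mul_zero, sub_zero] at hsub
  have h1 : αI ≤ αI * (((C.influential R).card : ℝ) -
      ((C.substConst j (finTwoEquiv c)).influential (R.assignFree j c hj hjp)).card) := by
    have h2 : (1 : ℝ) ≤ ((C.influential R).card : ℝ) -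
        ((C.substConst j (finTwoEquiv c)).influential (R.assignFree j c hj hjp)).card := by linarith
    have := mul_le_mul_of_nonneg_left h2 hI
    rwa [mul_one] at this
  linarith

/-- A variable read by a gate is influential. [cite: LiYang2022, Def. 3.6] -/
theorem mem_influential_of_reads (C : Semicircuit n) (R : RdqSource n) {k : Fin C.m} {a : Fin 2} {j : Fin n}
    (h : C.arg k a = .var j) : j ∈ C.influential R := by
  classical
  unfold influential; rw [mem_filter]
  refine ⟨mem_univ _, Or.inl ?_⟩
  unfold fanout
  refine Nat.one_le_iff_ne_zero.mpr fun hsum => ?_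
  have := (sum_eq_zero_iff.mp hsum) k (mem_univ _)
  rw [card_eq_zero, filter_eq_empty_iff] at this
  exact this (mem_univ a) h

/-- **The count of Case 3**: in a pre-normalized circuit computing an affine disperser on a
source of dimension `≥ 2d`, after the constant substitution `x_j := b` trivializing the ∧-type
gate `G` read by `x_j`, if `fanout(x_j) + fanout(G) ≥ 4` then at least `4` gates are doomed:
the readers of `x_j` and of `G`, and — "if a gate is fed by both `G` and `x` (i.e. double
counted), it is then trivialized and its descendants are degenerated" — the reader of a
double-counted gate (which is not the output), resp. the reader of that reader.
[cite: LiYang2022, §4.1 (Case 3)] -/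
theorem four_le_card_doomed (hf : IsAffineDisperser f d) {R₁ : RdqSource n} (hd : 2 * d ≤ R₁.dim)
    (hN : C.PreNormalized) {j : Fin n} {b : Bool} (hF₁ : (C.substConst j b).Fair)
    (hC₁ : (C.substConst j b).ComputesRestr f R₁)
    {G : Fin C.m} {aG : Fin 2} (hGj : C.arg G aG = .var j) (hand : IsAndOp (C.op G))
    (htriv : (C.substConst j b).liveFn G aG b false = (C.substConst j b).liveFn G aG b true)
    (h4 : 4 ≤ C.fanout (.var j) + C.fanout (.gate G)) :
    4 ≤ (C.substConst j b).doomed.card := by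
  classical
  set C₁ := C.substConst j b with hC₁def
  -- syntactic constancy in `C₁`
  have h₀ : C₁.arg G aG = .const b := by
    show (C.arg G aG).substConst j b = .const b
    rw [hGj, Node.substConst_var_self]
  have hsynG : ∃ c, C₁.SynVal (.gate G) c := ⟨_, SynVal.of_trivialized C₁ h₀ htriv⟩
  have hwire : ∀ (k : Fin C.m) (p : Fin 2), (C.arg k p = .var j ∨ C.arg k p = .gate G) →
      ∃ c, C₁.SynVal (C₁.arg k p) c := by
    rintro k p (h | h)
    · refine ⟨b, ?_⟩
      show C₁.SynVal ((C.arg k p).substConst j b) b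
      rw [h, Node.substConst_var_self]; exact .const b
    · show ∃ c, C₁.SynVal ((C.arg k p).substConst j b) c
      rw [h]; exact hsynG
  have hgate : ∀ (k : Fin C.m) (p : Fin 2) (k' : Fin C.m), C.arg k p = .gate k' → C₁.arg k p = .gate k' := by
    intro k p k' h
    show (C.arg k p).substConst j b = .gate k'
    rw [h]; rfl
  -- the counted sets
  set A := univ.filter fun k => ∃ a, C.arg k a = .var j with hA
  set B := univ.filter fun k => ∃ a, C.arg k a = .gate G with hB
  have hAcard : A.card = C.fanout (.var j) := (C.fanout_eq_card_readers hN.arg_zero_ne_arg_one _).symm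
  have hBcard : B.card = C.fanout (.gate G) := (C.fanout_eq_card_readers hN.arg_zero_ne_arg_one _).symm
  have hGK : G ∉ C.xorPart := C.not_mem_xorPart_of_isAndOp hand
  have hGA : G ∈ A := by rw [hA, mem_filter]; exact ⟨mem_univ _, aG, hGj⟩
  have hGB : G ∉ B := by
    rw [hB, mem_filter]; rintro ⟨-, a, ha⟩; exact C.arg_ne_self_of_not_mem hGK a ha
  -- `A ∪ B` is doomed
  have hABdoom : A ∪ B ⊆ C₁.doomed := by
    intro k hk
    rw [mem_union, hA, hB, mem_filter, mem_filter] at hk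
    rcases hk with ⟨-, a, ha⟩ | ⟨-, a, ha⟩
    · exact C₁.mem_doomed_iff.mpr ⟨a, hwire k a (Or.inl ha)⟩
    · exact C₁.mem_doomed_iff.mpr ⟨a, hwire k a (Or.inr ha)⟩
  -- `|A ∪ B| ≥ 3`
  have hAB3 : 3 ≤ (A ∪ B).card := by
    by_cases hA3 : 3 ≤ A.card
    · exact hA3.trans (card_le_card subset_union_left)
    · have hB2 : 2 ≤ B.card := by omega
      have : insert G B ⊆ A ∪ B := by
        intro k hk
        rw [mem_insert] at hk
        rcases hk with rfl | hk
        · exact mem_union_left _ hGA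
        · exact mem_union_right _ hk
      have h := card_le_card this
      rw [card_insert_of_notMem hGB] at h
      omega
  by_cases hAB4 : 4 ≤ (A ∪ B).card
  · exact hAB4.trans (card_le_card hABdoom)
  have hABeq : (A ∪ B).card = 3 := by omega
  -- a double-counted reader `Q`
  have hinter : (A ∩ B).Nonempty := by
    rw [← card_pos]
    have := card_union_add_card_inter A B
    omega
  obtain ⟨Q, hQ⟩ := hinter
  rw [mem_inter] at hQ
  have hQG : Q ≠ G := fun h => hGB (h ▸ hQ.2)
  obtain ⟨ρ, hρ⟩ := C.exists_rank
  -- a syntactically constant gate of `C₁` is read by some gate of `C`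
  have hreader : ∀ (k : Fin C.m) (c : Bool), C₁.SynVal (.gate k) c → ∃ (k' : Fin C.m) (a : Fin 2), C.arg k' a = .gate k := by
    intro k c hk
    have hout₁ : C₁.out ≠ .gate k := out_ne_of_synVal hf hd hF₁ hC₁ hk
    have hout : C.out ≠ .gate k := fun h => hout₁ (by show C.out.substConst j b = .gate k; rw [h]; rfl)
    by_contra hno
    push Not at hno
    have h0 : C.fanout (.gate k) = 0 := (fanout_eq_zero_iff C _).mpr hno
    exact hout (hN.out_of_fanout_eq_zero k h0)
  -- wires of a gate in `A ∪ B` that also reads a syntactically constant gate `k'` other than `x_j`/`G`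
  have hsyn_of_mem : ∀ (k k' : Fin C.m) (a : Fin 2), k ∈ A ∪ B → C.arg k a = .gate k' →
      (∃ c, C₁.SynVal (.gate k') c) → Node.gate k' ≠ (Node.var j : Node n C.m) → k' ≠ G →
      ∃ c, C₁.SynVal (.gate k) c := by
    intro k k' a hk hka hk' _ hk'G
    refine SynVal.of_wires C₁ fun p => ?_
    by_cases hp : p = a
    · subst hp; rw [hgate k p k' hka]; exact hk'
    · -- the other position holds `x_j` or `G`
      have hother : ∀ {u : Node n C.m}, (∃ a', C.arg k a' = u) → u ≠ .gate k' → C.arg k p = u := by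
        rintro u ⟨a', ha'⟩ hu
        have : a' = p := by
          by_contra hne
          have : a' = a := by
            obtain rfl | rfl : a = 0 ∨ a = 1 := by fin_cases a <;> simp
            all_goals obtain rfl | rfl : p = 0 ∨ p = 1 := by fin_cases p <;> simp
            all_goals obtain rfl | rfl : a' = 0 ∨ a' = 1 := by fin_cases a' <;> simp
            all_goals first | rfl | exact absurd rfl hp | exact absurd rfl hne
          subst this
          exact hu (ha'.symm.trans hka)
        subst this; exact ha'
      rw [mem_union, hA, hB, mem_filter, mem_filter] at hk
      rcases hk with ⟨-, hk⟩ | ⟨-, hk⟩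
      · exact hwire k p (Or.inl (hother hk (fun h => by cases h)))
      · exact hwire k p (Or.inr (hother hk (fun h => hk'G (Node.gate.inj h).symm)))
  -- `Q` is syntactically constant (fed by `x_j` and `G`)
  obtain ⟨aj, haj⟩ := (mem_filter.mp hQ.1).2
  obtain ⟨a', ha'⟩ := (mem_filter.mp hQ.2).2
  have hsynQ : ∃ c, C₁.SynVal (.gate Q) c := by
    have haa : aj ≠ a' := fun h => by subst h; rw [haj] at ha'; cases ha'
    refine SynVal.of_wires C₁ fun p => ?_
    by_cases hp : p = aj
    · subst hp; exact hwire _ _ (Or.inl haj)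
    · have : p = a' := fin2_eq_of_ne_of_ne haa hp
      subst this; exact hwire _ _ (Or.inr ha')
  obtain ⟨cQ, hcQ⟩ := hsynQ
  -- its reader `Q₁`
  obtain ⟨Q₁, a₁, hQ₁⟩ := hreader Q cQ hcQ
  have hQK : Q ∉ C.xorPart ∧ ρ G < ρ Q := hρ G Q a' ha' hGK
  have hQ₁K : Q₁ ∉ C.xorPart ∧ ρ Q < ρ Q₁ := hρ Q Q₁ a₁ hQ₁ hQK.1
  have hQ₁G : Q₁ ≠ G := fun h => by subst h; omega
  have hQ₁Q : Q₁ ≠ Q := fun h => by subst h; omega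
  have hQ₁doom : Q₁ ∈ C₁.doomed := C₁.mem_doomed_of_reads (hgate Q₁ a₁ Q hQ₁) hcQ
  by_cases hQ₁S : Q₁ ∈ A ∪ B
  · -- `Q₁` is syntactically constant too; its reader `Q₂` is a fourth doomed gate
    obtain ⟨c₁, hc₁⟩ := hsyn_of_mem Q₁ Q a₁ hQ₁S hQ₁ ⟨cQ, hcQ⟩ (fun h => by cases h) hQG
    obtain ⟨Q₂, a₂, hQ₂⟩ := hreader Q₁ c₁ hc₁
    have hQ₂K := hρ Q₁ Q₂ a₂ hQ₂ hQ₁K.1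
    have hQ₂doom : Q₂ ∈ C₁.doomed := C₁.mem_doomed_of_reads (hgate Q₂ a₂ Q₁ hQ₂) hc₁
    have hQ₂G : Q₂ ≠ G := fun h => by subst h; omega
    have hQ₂Q : Q₂ ≠ Q := fun h => by subst h; omega
    have hQ₂Q₁ : Q₂ ≠ Q₁ := fun h => by subst h; omega
    have hQ₂S : Q₂ ∉ A ∪ B := fun h => by
      have hsub : ({G, Q, Q₁, Q₂} : Finset (Fin C.m)) ⊆ A ∪ B := by
        intro k hk
        simp only [mem_insert, mem_singleton] at hk
        rcases hk with rfl | rfl | rfl | rfl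
        · exact mem_union_left _ hGA
        · exact mem_union_left _ hQ.1
        · exact hQ₁S
        · exact h
      have hc := card_le_card hsub
      rw [card_insert_of_notMem (by simp [hQG.symm, hQ₁G.symm, hQ₂G.symm]),
        card_insert_of_notMem (by simp [hQ₁Q.symm, hQ₂Q.symm]), card_pair hQ₂Q₁.symm] at hc
      omega
    calc 4 = (insert Q₂ (A ∪ B)).card := by rw [card_insert_of_notMem hQ₂S, hABeq]
      _ ≤ C₁.doomed.card := card_le_card (insert_subset hQ₂doom hABdoom)
  · calc 4 = (insert Q₁ (A ∪ B)).card := by rw [card_insert_of_notMem hQ₁S, hABeq]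
      _ ≤ C₁.doomed.card := card_le_card (insert_subset hQ₁doom hABdoom)

/-- **Case 3 of Li–Yang's proof of Theorem 4.1**: in a pre-normalized fair semicircuit computing
`f|_R`, an unprotected variable `x_j` (protected ones are Case 1) feeding an ∧-type gate `G`
with `fanout(x_j) + fanout(G) ≥ 4`. The constant substitution `x_j := c` trivializing `G` is
followed by four eliminations (`four_le_card_doomed`, `cascade_doomed`):
`Δμ ≥ 4 - 4α_φ + α_I ≥ δ`, `t = 1`. [cite: LiYang2022, §4.1 (Case 3)] -/
theorem case3 (hf : IsAffineDisperser f d) (hd : 2 * d + 2 < R.dim) (hF : C.Fair)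
    (hC : C.ComputesRestr f R) (hP : C.IsPacking P) (hφ : 0 ≤ αφ) (hI : 0 ≤ αI) (αQ : ℝ)
    (hN : C.PreNormalized) {j : Fin n} (hjp : ¬ R.Protected j)
    {G : Fin C.m} {aG : Fin 2} (hGj : C.arg G aG = .var j) (hand : IsAndOp (C.op G))
    (h4 : 4 ≤ C.fanout (.var j) + C.fanout (.gate G)) :
    C.StepBranch2 f R αφ αI αQ P := by
  classical
  -- `x_j` is free (it is read) and influential
  have hjinf : j ∈ C.influential R := C.mem_influential_of_reads R hGj
  have hj : R.Free j := by
    by_contra hnf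
    have h0 := hC.1 j hnf
    have := (fanout_eq_zero_iff C _).mp h0 G aG
    exact this hGj
  obtain ⟨c₁, c₂, c₃, hop⟩ := hand
  -- the constant trivializing `G` at position `aG`
  let bG : Bool := if aG = 0 then c₁ else c₂
  have hbG : bG = if aG = 0 then c₁ else c₂ := rfl
  let c : ZMod 2 := finTwoEquiv.symm bG
  have hb : finTwoEquiv c = bG := finTwoEquiv.apply_symm_apply bG
  let C₁ := C.substConst j (finTwoEquiv c)
  have hF₁ : C₁.Fair := hF.substConst j _
  have hC₁ : C₁.ComputesRestr f (R.assignFree j c hj hjp) := hC.substConst_assignFree hj hjp c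
  have hP₁ : C₁.IsPacking (C.substConstPacking j (finTwoEquiv c) P) := hP.substConst
  have hd' : 2 * d + 2 ≤ (R.assignFree j c hj hjp).dim := by
    have := RdqSource.dim_assignFree (b := c) hj hjp; omega
  have htriv : C₁.liveFn G aG (finTwoEquiv c) false = C₁.liveFn G aG (finTwoEquiv c) true := by
    rw [hb]
    show C.liveFn G aG bG false = C.liveFn G aG bG true
    unfold liveFn
    obtain rfl | rfl : aG = 0 ∨ aG = 1 := by fin_cases aG <;> simp
    · rw [if_pos rfl, if_pos rfl, hop, hop, hbG, if_pos rfl]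
      cases c₁ <;> cases c₂ <;> cases c₃ <;> rfl
    · rw [if_neg (by decide), if_neg (by decide), hop, hop, hbG, if_neg (by decide)]
      cases c₁ <;> cases c₂ <;> cases c₃ <;> rfl
  have hcount : 4 ≤ C₁.doomed.card :=
    four_le_card_doomed hf (R₁ := R.assignFree j c hj hjp) (by omega) hN hF₁ hC₁ hGj ⟨c₁, c₂, c₃, hop⟩ htriv h4
  obtain ⟨D', P', hF', hCD', hP', -, hμ'⟩ := cascade_doomed hf hd' hφ hI αQ 4 C₁ _ hF₁ hC₁ hP₁ hcount
  refine stepBranch2_of_assignFree_elims hφ hI hj hjp c hP hjinf 4 ?_ hF' hCD' hP' ?_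
  · have := liYangDelta_le_case3 αφ αI αQ; push_cast; linarith
  · push_cast at hμ' ⊢; linarith

end Case3

end Semicircuit

end Literature.Computability.Complexity
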